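import Literature.NumberTheory.Sieve.HardyLittlewoodChowlaParams
import HarnessLib

/-!
# Hardy–Littlewood–Chowla on average (Lichtman–Teräväinen 2022): the parameter regime of §4

Topic `Literature/NumberTheory/Sieve`, companion of `HardyLittlewoodChowla.lean` (the named facts
`lichtmanTeravainen2022_hlc_avg(_liouville)` = J. D. Lichtman, J. Teräväinen, *On the
Hardy–Littlewood–Chowla conjecture on average*, Forum Math. Sigma 10 (2022) e57, arXiv:2111.08912
[LichtmanTeravainen2022], Theorem 1.2 (i)) and of `HardyLittlewoodChowlaProofs.lean` (the assembly
of Theorem 1.2 (i)).  Everything in this file is PROVED (elementary real inequalities); it introduces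
no definition and no named fact.

The bookkeeping of **§4 of the paper** (held copy `paper:arxiv-2111.08912`, pp. 10–11): with
`t = log X`, `h = log H`, `(log X)^{ℓ+ε} ≤ H ≤ exp((log X)^a)`, `V = (log H)^B` (`B = 2j(ℓ+1)`,
`aB = 1/1000`), `W = V⁵`, `P₁ = W^{200}`, `Q₁ = 2H/W³`:

* `regime_typical` — the side conditions of [MRT2015, Thm 2.3] / Proposition 2.1
  (`typical_window_sq_sum_le`) and the numerical form `60 log V ≤ (1/6) log log X' - C` of the
  pretentiousness hypothesis;
* `regime_rest` — the side conditions of Lemma 2.11 (`exceptional_sum_le`), the density loss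
  `log P₁/log Q₁ ≤ 2000 B log log H/log H`, and the growth facts absorbing the secondary terms;
* `main_term_le` — the arithmetic turning the output of Proposition 3.2 (`holder_fourier_bound`)
  with the bounds of Propositions 2.1 and 2.7 into `S ≪ H X/log H`;
* `abs_corr_le_decomp` — the decomposition of one correlation `∑_n ∏Λ(n+a) ∏ g(n+b) g(n+h)` into the
  typical part, the atypical part and the `n < 2H` truncation.

## References

* J. D. Lichtman, J. Teräväinen, Forum Math. Sigma 10 (2022) e57, arXiv:2111.08912, §4.
  [cite: LichtmanTeravainen2022, §4]
-/

noncomputable section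

open Finset
open scoped ArithmeticFunction.vonMangoldt

namespace Literature.NumberTheory.Sieve.LichtmanTeravainen2022.Liouville

/-- `Z ≤ T^m`, `T ≥ 0`, `m ≠ 0` ⟹ `Z^{1/m} ≤ T`. [folklore] -/
theorem rpow_one_div_le_of_le_pow {Z T : ℝ} {m : ℕ} (hm : m ≠ 0) (hZ : 0 ≤ Z) (hT : 0 ≤ T)
    (h : Z ≤ T ^ m) : Z ^ (1 / (m : ℝ)) ≤ T := by
  calc Z ^ (1 / (m : ℝ)) ≤ (T ^ m) ^ (1 / (m : ℝ)) :=
        Real.rpow_le_rpow hZ h (by positivity)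
    _ = T := by rw [one_div]; exact Real.pow_rpow_inv_natCast hT hm


/-- **The main term after Hölder** (the arithmetic of [LichtmanTeravainen2022, §4, display (4.3)
and the lines following it]): from `H S ≤ H^{1/2} (A₂ (2HU)^{j-1} X'^{j-1} A₁)^{1/2j}`
(`holder_fourier_bound`) with `A₂ = C₂ (2H)² X'/V + (2H)³` (Prop. 2.1), `A₁ = C₁ X (log log X)^{2jℓ}
H^{2j-1}` (Prop. 2.7), `U ≤ X'`, `2HV ≤ X'`, `V = (log H)^{2j(ℓ+1)}` and `log log X' ≤ 2 log H`:
`S ≤ K 2^{ℓ+1} H X / log H`. [cite: LichtmanTeravainen2022, §4 (proof of Theorem 1.6)] -/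
theorem main_term_le {S Hr Xr Y U V hh A₁ A₂ C₁ C₂ LX LY : ℝ} {j ℓ : ℕ}
    (hj : 1 ≤ j) (hHr : 0 < Hr) (hXr : 0 < Xr) (hY : Xr ≤ Y) (hY2 : Y ≤ 2 * Xr)
    (hU0 : 0 ≤ U) (hUY : U ≤ Y) (hV0 : 0 < V) (h2HV : 2 * Hr * V ≤ Y) (hh0 : 0 < hh)
    (hVdef : V = hh ^ (2 * j * (ℓ + 1)))
    (hC₁ : 0 ≤ C₁) (hC₂ : 0 < C₂) (hLX0 : 0 ≤ LX) (hLXY : LX ≤ LY) (hLY : LY ≤ 2 * hh)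
    (hA₂def : A₂ = C₂ * (2 * Hr) ^ 2 * Y / V + (2 * Hr) ^ 3)
    (hA₁def : A₁ = C₁ * Xr * LX ^ ((j + j) * ℓ) * Hr ^ (2 * j - 1))
    (hS1 : Hr * S ≤ Hr ^ (1 / 2 : ℝ) *
      (A₂ * ((2 * Hr) * U) ^ (j - 1) * (Y ^ (j - 1) * A₁)) ^ (1 / (2 * j) : ℝ)) :
    S ≤ ((C₂ + 1) * C₁ * 2 ^ (j + 1) + 1) * 2 ^ (ℓ + 1) * Hr * Xr / hh := by
  -- notation
  set K₀ : ℝ := (C₂ + 1) * C₁ * 2 ^ (j + 1) with hK₀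
  have hK₀0 : 0 ≤ K₀ := by rw [hK₀]; positivity
  set K₆ : ℝ := K₀ + 1 with hK₆
  have hK₆1 : 1 ≤ K₆ := by rw [hK₆]; linarith
  have hY0 : 0 < Y := by linarith
  have hLY0 : 0 ≤ LY := hLX0.trans hLXY
  have hA₁0 : 0 ≤ A₁ := by rw [hA₁def]; positivity
  have hA₂0 : 0 ≤ A₂ := by rw [hA₂def]; positivity
  set Zb : ℝ := A₂ * ((2 * Hr) * U) ^ (j - 1) * (Y ^ (j - 1) * A₁) with hZb
  have hZb0 : 0 ≤ Zb := by rw [hZb]; positivity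
  set Tm : ℝ := K₆ * Hr * Real.sqrt Hr * Y * LY ^ ℓ / hh ^ (ℓ + 1) with hTm
  have hTm0 : 0 ≤ Tm := by rw [hTm]; positivity
  -- `Zb ≤ Tm^{2j}`
  have hZT : Zb ≤ Tm ^ (2 * j) := by
    have hA₂le : A₂ ≤ (C₂ + 1) * (2 * Hr) ^ 2 * Y / V := by
      have h3 : (2 * Hr) ^ 3 ≤ (2 * Hr) ^ 2 * Y / V := by
        rw [le_div_iff₀ hV0]
        calc (2 * Hr) ^ 3 * V = (2 * Hr) ^ 2 * (2 * Hr * V) := by ring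
          _ ≤ (2 * Hr) ^ 2 * Y := mul_le_mul_of_nonneg_left h2HV (by positivity)
      rw [hA₂def]
      have : C₂ * (2 * Hr) ^ 2 * Y / V + (2 * Hr) ^ 2 * Y / V =
          (C₂ + 1) * (2 * Hr) ^ 2 * Y / V := by ring
      linarith
    have hUle : ((2 * Hr) * U) ^ (j - 1) ≤ ((2 * Hr) * Y) ^ (j - 1) :=
      pow_le_pow_left₀ (by positivity) (mul_le_mul_of_nonneg_left hUY (by positivity)) _
    have hA₁le : A₁ ≤ C₁ * Y * LY ^ ((j + j) * ℓ) * Hr ^ (2 * j - 1) := by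
      rw [hA₁def]
      have h2 : LX ^ ((j + j) * ℓ) ≤ LY ^ ((j + j) * ℓ) := pow_le_pow_left₀ hLX0 hLXY _
      have h3 : C₁ * Xr ≤ C₁ * Y := mul_le_mul_of_nonneg_left hY hC₁
      exact mul_le_mul_of_nonneg_right
        (mul_le_mul h3 h2 (by positivity) (by positivity)) (by positivity)
    have hprod : Zb ≤ K₀ * Hr ^ (3 * j) * Y ^ (2 * j) * LY ^ ((j + j) * ℓ) / V := by
      calc Zb ≤ ((C₂ + 1) * (2 * Hr) ^ 2 * Y / V) * ((2 * Hr) * Y) ^ (j - 1) *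
            (Y ^ (j - 1) * (C₁ * Y * LY ^ ((j + j) * ℓ) * Hr ^ (2 * j - 1))) := by
            rw [hZb]
            refine mul_le_mul (mul_le_mul hA₂le hUle (by positivity) (by positivity))
              (mul_le_mul_of_nonneg_left hA₁le (by positivity)) (by positivity) (by positivity)
        _ = K₀ * Hr ^ (3 * j) * Y ^ (2 * j) * LY ^ ((j + j) * ℓ) / V := by
            rw [hK₀]
            have e1 : Hr ^ (3 * j) = Hr ^ 2 * Hr ^ (j - 1) * Hr ^ (2 * j - 1) := by
              rw [← pow_add, ← pow_add]; congr 1; omega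
            have e2 : Y ^ (2 * j) = Y * Y ^ (j - 1) * Y ^ (j - 1) * Y := by
              have : 2 * j = 1 + (j - 1) + (j - 1) + 1 := by omega
              rw [this, pow_add, pow_add, pow_add, pow_one]
            have e3 : (2 : ℝ) ^ (j + 1) = 2 ^ 2 * 2 ^ (j - 1) := by
              rw [← pow_add]; congr 1; omega
            rw [e1, e2, e3, mul_pow]
            field_simp
            ring
    have hTpow : Tm ^ (2 * j) = K₆ ^ (2 * j) * Hr ^ (3 * j) * Y ^ (2 * j) *
        LY ^ ((j + j) * ℓ) / V := by
      rw [hTm, div_pow, mul_pow, mul_pow, mul_pow, mul_pow]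
      have e1 : Real.sqrt Hr ^ (2 * j) = Hr ^ j := by
        rw [pow_mul, Real.sq_sqrt hHr.le]
      have e2 : (hh ^ (ℓ + 1)) ^ (2 * j) = V := by
        rw [hVdef, ← pow_mul]; congr 1; ring
      have e3 : (LY ^ ℓ) ^ (2 * j) = LY ^ ((j + j) * ℓ) := by
        rw [← pow_mul]; congr 1; ring
      have e4 : Hr ^ (2 * j) * Hr ^ j = Hr ^ (3 * j) := by
        rw [← pow_add]; congr 1; ring
      rw [e1, e2, e3, ← e4]
      ring
    have hKpow : K₀ ≤ K₆ ^ (2 * j) := by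
      calc K₀ ≤ K₆ := by rw [hK₆]; linarith
        _ ≤ K₆ ^ (2 * j) := le_self_pow₀ hK₆1 (by omega)
    rw [hTpow]
    refine hprod.trans ?_
    have : 0 ≤ Hr ^ (3 * j) * Y ^ (2 * j) * LY ^ ((j + j) * ℓ) / V := by positivity
    calc K₀ * Hr ^ (3 * j) * Y ^ (2 * j) * LY ^ ((j + j) * ℓ) / V
        = K₀ * (Hr ^ (3 * j) * Y ^ (2 * j) * LY ^ ((j + j) * ℓ) / V) := by ring
      _ ≤ K₆ ^ (2 * j) * (Hr ^ (3 * j) * Y ^ (2 * j) * LY ^ ((j + j) * ℓ) / V) :=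
          mul_le_mul_of_nonneg_right hKpow this
      _ = _ := by ring
  -- take the root
  have h1 : Zb ^ (1 / (2 * j) : ℝ) ≤ Tm := by
    have := rpow_one_div_le_of_le_pow (m := 2 * j) (by omega) hZb0 hTm0 hZT
    push_cast at this
    exact this
  have h2 : Hr * S ≤ Hr ^ (1 / 2 : ℝ) * Tm :=
    hS1.trans (mul_le_mul_of_nonneg_left h1 (by positivity))
  have h3 : Hr ^ (1 / 2 : ℝ) * Tm = Hr * (K₆ * Hr * Y * LY ^ ℓ / hh ^ (ℓ + 1)) := by
    rw [hTm, ← Real.sqrt_eq_rpow]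
    have : Real.sqrt Hr * Real.sqrt Hr = Hr := Real.mul_self_sqrt hHr.le
    calc Real.sqrt Hr * (K₆ * Hr * Real.sqrt Hr * Y * LY ^ ℓ / hh ^ (ℓ + 1))
        = (Real.sqrt Hr * Real.sqrt Hr) * (K₆ * Hr * Y * LY ^ ℓ / hh ^ (ℓ + 1)) := by ring
      _ = _ := by rw [this]
  rw [h3] at h2
  have h4 : S ≤ K₆ * Hr * Y * LY ^ ℓ / hh ^ (ℓ + 1) := le_of_mul_le_mul_left h2 hHr
  have h5 : LY ^ ℓ ≤ (2 * hh) ^ ℓ := pow_le_pow_left₀ hLY0 hLY _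
  have h6 : K₆ * Hr * Y * LY ^ ℓ / hh ^ (ℓ + 1) ≤ K₆ * Hr * (2 * Xr) * (2 * hh) ^ ℓ / hh ^ (ℓ + 1) := by
    refine div_le_div_of_nonneg_right ?_ (by positivity)
    exact mul_le_mul (mul_le_mul_of_nonneg_left hY2 (by positivity)) h5 (by positivity)
      (by positivity)
  have h7 : K₆ * Hr * (2 * Xr) * (2 * hh) ^ ℓ / hh ^ (ℓ + 1) = K₆ * 2 ^ (ℓ + 1) * Hr * Xr / hh := by
    rw [mul_pow, pow_succ]
    field_simp
    ring
  calc S ≤ K₆ * Hr * Y * LY ^ ℓ / hh ^ (ℓ + 1) := h4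
    _ ≤ K₆ * Hr * (2 * Xr) * (2 * hh) ^ ℓ / hh ^ (ℓ + 1) := h6
    _ = K₆ * 2 ^ (ℓ + 1) * Hr * Xr / hh := h7

/-- A product of `1`-bounded complex numbers is `1`-bounded. [folklore] -/
theorem norm_finsetProd_le_one {ι : Type*} (s : Finset ι) (f : ι → ℂ) (hf : ∀ i ∈ s, ‖f i‖ ≤ 1) :
    ‖∏ i ∈ s, f i‖ ≤ 1 := by
  rw [norm_prod]
  calc ∏ i ∈ s, ‖f i‖ ≤ ∏ _i ∈ s, (1 : ℝ) :=
        Finset.prod_le_prod (fun i _ => norm_nonneg _) hf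
    _ = 1 := Finset.prod_const_one


/-- **One shift `h ∉ B'`** (the decomposition `g = g𝟙_𝒮 + g𝟙_{𝒮ᶜ}` of [LichtmanTeravainen2022,
§4]): with `w(n) = 𝟙_{[2H,X]}(n) ∏_a Λ(n+a) ∏_{b∈B'} g(n+b)` and any `u` such that `g - u` vanishes at
the "typical" `m ≤ X + 2H` and is `1`-bounded elsewhere,
`|∑_{n ≤ X} ∏_a Λ(n+a) ∏_{b ∈ {h} ∪ B'} g(n+b)| ≤ |∑_n w(n) u(n+h)| + ∑_{n ≤ X, n+h atypical} ∏_a Λ(n+a)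
 + ∑_{n < 2H} ∏_a Λ(n+a)`. [cite: LichtmanTeravainen2022, §4 (proof of Theorem 1.6)] -/
theorem abs_corr_le_decomp (g u : ℕ → ℂ) (hg1 : ∀ n, ‖g n‖ ≤ 1) (gr : ℕ → ℝ)
    (hgr : ∀ n, ((gr n : ℝ) : ℂ) = g n) (A B' : Finset ℕ) (X H hh : ℕ) (hhB : hh ∉ B')
    (hhH : hh ≤ 2 * H) (typ : ℕ → Prop) [DecidablePred typ]
    (hdiff : ∀ m : ℕ, 1 ≤ m → m ≤ X + 2 * H → ‖g m - u m‖ ≤ if typ m then 0 else 1) :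
    |∑ n ∈ Icc 1 X, (∏ a ∈ A, (Λ (n + a) : ℝ)) * ∏ b ∈ insert hh B', gr (n + b)| ≤
      ‖∑ n ∈ Icc 1 X, (if 2 * H ≤ n ∧ n ≤ X then
          ((∏ a ∈ A, (Λ (n + a) : ℝ) : ℝ) : ℂ) * ∏ b ∈ B', g (n + b) else 0) * u (n + hh)‖ +
        ∑ n ∈ Icc 1 X, (if typ (n + hh) then (0 : ℝ) else ∏ a ∈ A, (Λ (n + a) : ℝ)) +
        ∑ n ∈ (Icc 1 X).filter (fun n => n < 2 * H), ∏ a ∈ A, (Λ (n + a) : ℝ) := by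
  set G : ℕ → ℂ := fun n => ∏ b ∈ B', g (n + b) with hGdef
  have hG1 : ∀ n, ‖G n‖ ≤ 1 := fun n => norm_finsetProd_le_one _ _ fun b _ => hg1 _
  set w : ℕ → ℂ := fun n =>
    if 2 * H ≤ n ∧ n ≤ X then ((∏ a ∈ A, Λ (n + a) : ℝ) : ℂ) * G n else 0 with hwdef
  have hΛ0 : ∀ n, 0 ≤ ∏ a ∈ A, (Λ (n + a) : ℝ) := fun n =>
    Finset.prod_nonneg fun a _ => ArithmeticFunction.vonMangoldt_nonneg
  show _ ≤ ‖∑ n ∈ Icc 1 X, w n * u (n + hh)‖ + _ + _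
  -- complexify
  have hcx : (((∑ n ∈ Icc 1 X, (∏ a ∈ A, (Λ (n + a) : ℝ)) * ∏ b ∈ insert hh B', gr (n + b)
      : ℝ)) : ℂ) = ∑ n ∈ Icc 1 X, ((∏ a ∈ A, (Λ (n + a) : ℝ) : ℝ) : ℂ) * G n * g (n + hh) := by
    push_cast
    refine Finset.sum_congr rfl fun n _ => ?_
    rw [Finset.prod_insert hhB]
    simp only [hgr, hGdef]
    ring
  have habs : |∑ n ∈ Icc 1 X, (∏ a ∈ A, (Λ (n + a) : ℝ)) * ∏ b ∈ insert hh B', gr (n + b)| =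
      ‖∑ n ∈ Icc 1 X, ((∏ a ∈ A, (Λ (n + a) : ℝ) : ℝ) : ℂ) * G n * g (n + hh)‖ := by
    rw [← hcx, Complex.norm_real, Real.norm_eq_abs]
  rw [habs]
  -- split the sum
  have hsplit : ∑ n ∈ Icc 1 X, ((∏ a ∈ A, (Λ (n + a) : ℝ) : ℝ) : ℂ) * G n * g (n + hh) =
      ∑ n ∈ Icc 1 X, w n * g (n + hh) +
        ∑ n ∈ (Icc 1 X).filter (fun n => n < 2 * H),
          ((∏ a ∈ A, (Λ (n + a) : ℝ) : ℝ) : ℂ) * G n * g (n + hh) := by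
    rw [← Finset.sum_filter_add_sum_filter_not (Icc 1 X) (fun n => 2 * H ≤ n)]
    congr 1
    · rw [Finset.sum_filter]
      refine Finset.sum_congr rfl fun n hn => ?_
      rw [Finset.mem_Icc] at hn
      simp only [hwdef]
      by_cases h2 : 2 * H ≤ n
      · rw [if_pos h2, if_pos ⟨h2, hn.2⟩]
      · rw [if_neg h2, if_neg (fun h' => h2 h'.1), zero_mul]
    · refine Finset.sum_congr ?_ fun _ _ => rfl
      ext n; simp only [Finset.mem_filter, not_le]
  have hsplit2 : ∑ n ∈ Icc 1 X, w n * g (n + hh) =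
      ∑ n ∈ Icc 1 X, w n * u (n + hh) + ∑ n ∈ Icc 1 X, w n * (g (n + hh) - u (n + hh)) := by
    rw [← Finset.sum_add_distrib]
    exact Finset.sum_congr rfl fun n _ => by ring
  rw [hsplit, hsplit2]
  refine (norm_add_le _ _).trans (add_le_add ((norm_add_le _ _).trans (add_le_add le_rfl ?_)) ?_)
  · refine (norm_sum_le _ _).trans (Finset.sum_le_sum fun n hn => ?_)
    rw [Finset.mem_Icc] at hn
    rw [norm_mul]
    have hwn : ‖w n‖ ≤ ∏ a ∈ A, (Λ (n + a) : ℝ) := by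
      simp only [hwdef]
      split_ifs
      · rw [norm_mul, Complex.norm_real, Real.norm_eq_abs, abs_of_nonneg (hΛ0 n)]
        calc (∏ a ∈ A, (Λ (n + a) : ℝ)) * ‖G n‖ ≤ (∏ a ∈ A, (Λ (n + a) : ℝ)) * 1 :=
              mul_le_mul_of_nonneg_left (hG1 n) (hΛ0 n)
          _ = _ := mul_one _
      · rw [norm_zero]; exact hΛ0 n
    have hd := hdiff (n + hh) (by omega) (by omega)
    split_ifs with htyp
    · rw [if_pos htyp] at hd
      have : ‖g (n + hh) - u (n + hh)‖ = 0 := le_antisymm hd (norm_nonneg _)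
      rw [this, mul_zero]
    · rw [if_neg htyp] at hd
      calc ‖w n‖ * ‖g (n + hh) - u (n + hh)‖ ≤ (∏ a ∈ A, (Λ (n + a) : ℝ)) * 1 :=
            mul_le_mul hwn hd (norm_nonneg _) (hΛ0 n)
        _ = _ := mul_one _
  · refine (norm_sum_le _ _).trans (Finset.sum_le_sum fun n _ => ?_)
    rw [norm_mul, norm_mul, Complex.norm_real, Real.norm_eq_abs, abs_of_nonneg (hΛ0 n)]
    calc (∏ a ∈ A, (Λ (n + a) : ℝ)) * ‖G n‖ * ‖g (n + hh)‖
        ≤ (∏ a ∈ A, (Λ (n + a) : ℝ)) * 1 * 1 :=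
          mul_le_mul (mul_le_mul_of_nonneg_left (hG1 n) (hΛ0 n)) (hg1 _) (norm_nonneg _)
            (by have := hΛ0 n; positivity)
      _ = _ := by ring

set_option maxHeartbeats 800000 in
/-- **The regime of Proposition 2.1** ([LichtmanTeravainen2022, §4]: the choice `W = V⁵`,
`P₁ = W^{200}`, `Q₁ = 2H/W³` with `V = (log H)^B`, `H ≤ exp((log X)^a)`, `aB = 1/1000`, places
`g𝟙_𝒮` in the range of [MRT2015, Thm 2.3]): the side conditions of `typical_window_sq_sum_le`, in
terms of `t = log X ≥ 1` and `h = log H` with `h ≤ t^a`. [cite: LichtmanTeravainen2022, §4] -/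
theorem regime_typical {t h a V₀ Cₚ s₁ : ℝ} {X H B : ℕ} (hB2 : 2 ≤ B)
    (haB : a * B = 1 / 1000) (ht1 : 1 ≤ t) (hXt : (X : ℝ) = Real.exp t)
    (hh2 : 2 ≤ h) (hHh : (H : ℝ) = Real.exp h) (hha : h ≤ t ^ a) (hat : t ^ a ≤ t)
    (hV₀ : V₀ ≤ h) (hs₁ : s₁ ≤ h) (hs₁' : ∀ x : ℝ, s₁ ≤ x → x ^ (1015 * B) ≤ 1 * Real.exp x)
    (hgrow : Real.exp (t ^ a) * t ≤ 1 / 8 * Real.exp t)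
    (hsq : Real.log 2 + t ^ a ≤ Real.sqrt (t / 2)) (hCₚ : Cₚ ≤ 8 / 75 * Real.log t) :
    V₀ ≤ h ^ B ∧ 1 ≤ h ^ B ∧
    (h ^ B) ^ 5 ≤ Real.log ((X + 2 * H : ℕ) : ℝ) ^ (1 / 125 : ℝ) ∧
    (h ^ B) ^ 1015 ≤ ((2 * H : ℕ) : ℝ) ∧
    ((2 * H : ℕ) : ℝ) * (h ^ B) ^ 75 ≤ ((X + 2 * H : ℕ) : ℝ) ∧
    ((2 * H : ℕ) : ℝ) * h ^ B ≤ ((X + 2 * H : ℕ) : ℝ) ∧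
    ((2 * H : ℕ) : ℝ) ≤ Real.exp (Real.sqrt (Real.log ((X + 2 * H : ℕ) : ℝ) / 2)) ∧
    Real.log ((2 * H : ℕ) : ℝ) ≤ h ^ B ∧ 1 ≤ (h ^ B) ^ 5 ∧
    5 * 12 * Real.log (h ^ B) ≤ 1 / 6 * Real.log (Real.log ((X + 2 * H : ℕ) : ℝ)) - Cₚ ∧
    (X : ℝ) ≤ ((X + 2 * H : ℕ) : ℝ) ∧ ((X + 2 * H : ℕ) : ℝ) ≤ 2 * X ∧ 8 * (H : ℝ) ≤ X := by
  have ht0 : 0 < t := by linarith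
  have hh1 : 1 ≤ h := by linarith
  have hh0 : 0 < h := by linarith
  have hX0 : (0 : ℝ) < X := by rw [hXt]; exact Real.exp_pos t
  have hH0 : (0 : ℝ) < H := by rw [hHh]; exact Real.exp_pos h
  have hB0 : (0 : ℝ) < B := by exact_mod_cast (show 0 < B by omega)
  set V : ℝ := h ^ B with hVdef
  have hV1 : 1 ≤ V := one_le_pow₀ hh1
  have hV0 : 0 < V := by linarith
  have hVh : h ≤ V := by rw [hVdef]; exact le_self_pow₀ hh1 (by omega)
  have hlogV : Real.log V = B * Real.log h := by rw [hVdef, Real.log_pow]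
  -- `H ≤ X/8`
  have hexpta : Real.exp (t ^ a) ≤ Real.exp t / 8 := by
    have : Real.exp (t ^ a) ≤ Real.exp (t ^ a) * t :=
      le_mul_of_one_le_right (Real.exp_pos _).le ht1
    linarith
  have hHle : (H : ℝ) ≤ Real.exp (t ^ a) := by
    rw [hHh]; exact Real.exp_le_exp.2 hha
  have hH8 : 8 * (H : ℝ) ≤ X := by rw [hXt]; linarith
  have hXX' : (X : ℝ) ≤ ((X + 2 * H : ℕ) : ℝ) := by push_cast; linarith
  have hX'le : ((X + 2 * H : ℕ) : ℝ) ≤ 2 * X := by push_cast; linarith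
  have hX'0 : (0 : ℝ) < ((X + 2 * H : ℕ) : ℝ) := by linarith
  have hlogX' : t ≤ Real.log ((X + 2 * H : ℕ) : ℝ) := by
    rw [show t = Real.log X by rw [hXt, Real.log_exp]]; exact Real.log_le_log hX0 hXX'
  have h2H : ((2 * H : ℕ) : ℝ) = 2 * H := by push_cast; ring
  have hlog2Hr : Real.log ((2 * H : ℕ) : ℝ) = Real.log 2 + h := by
    rw [h2H, Real.log_mul (by norm_num) hH0.ne', hHh, Real.log_exp]
  refine ⟨hV₀.trans hVh, hV1, ?_, ?_, ?_, ?_, ?_, ?_, one_le_pow₀ hV1, ?_, hXX', hX'le, hH8⟩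
  · -- `V^5 ≤ (log X')^{1/125}`
    have h1 : V ^ 5 = h ^ (5 * B) := by rw [hVdef, ← pow_mul, mul_comm]
    have h2 : h ^ (5 * B) ≤ (t ^ a) ^ (5 * B) := pow_le_pow_left₀ hh0.le hha _
    have h3 : (t ^ a) ^ (5 * B) = t ^ (1 / 200 : ℝ) := by
      rw [← Real.rpow_natCast, ← Real.rpow_mul ht0.le]
      congr 1; push_cast
      calc a * (5 * (B : ℝ)) = 5 * (a * B) := by ring
        _ = 1 / 200 := by rw [haB]; norm_num
    have h4 : t ^ (1 / 200 : ℝ) ≤ t ^ (1 / 125 : ℝ) :=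
      Real.rpow_le_rpow_of_exponent_le ht1 (by norm_num)
    have h5 : t ^ (1 / 125 : ℝ) ≤ Real.log ((X + 2 * H : ℕ) : ℝ) ^ (1 / 125 : ℝ) :=
      Real.rpow_le_rpow ht0.le hlogX' (by norm_num)
    rw [h1]; linarith
  · -- `V^{1015} ≤ 2H`
    have h1 : V ^ 1015 = h ^ (1015 * B) := by rw [hVdef, ← pow_mul, mul_comm]
    have h2 := hs₁' h hs₁
    rw [one_mul, ← hHh] at h2
    rw [h1, h2H]; linarith
  · -- `2H V^{75} ≤ X'`
    have h1 : V ^ 75 = h ^ (75 * B) := by rw [hVdef, ← pow_mul, mul_comm]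
    have h2 : h ^ (75 * B) ≤ (t ^ a) ^ (75 * B) := pow_le_pow_left₀ hh0.le hha _
    have h3 : (t ^ a) ^ (75 * B) = t ^ (3 / 40 : ℝ) := by
      rw [← Real.rpow_natCast, ← Real.rpow_mul ht0.le]
      congr 1; push_cast
      calc a * (75 * (B : ℝ)) = 75 * (a * B) := by ring
        _ = 3 / 40 := by rw [haB]; norm_num
    have h4 : t ^ (3 / 40 : ℝ) ≤ t := by
      conv_rhs => rw [← Real.rpow_one t]
      exact Real.rpow_le_rpow_of_exponent_le ht1 (by norm_num)
    have hV75 : V ^ 75 ≤ t := by rw [h1]; linarith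
    have h6 : (H : ℝ) * t ≤ Real.exp t / 8 := by
      calc (H : ℝ) * t ≤ Real.exp (t ^ a) * t := mul_le_mul_of_nonneg_right hHle ht0.le
        _ ≤ 1 / 8 * Real.exp t := hgrow
        _ = Real.exp t / 8 := by ring
    have h7 : (H : ℝ) * V ^ 75 ≤ (H : ℝ) * t := mul_le_mul_of_nonneg_left hV75 hH0.le
    rw [h2H]
    calc 2 * (H : ℝ) * V ^ 75 = 2 * ((H : ℝ) * V ^ 75) := by ring
      _ ≤ (X : ℝ) := by rw [hXt]; linarith
      _ ≤ _ := hXX'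
  · -- `2H V ≤ X'`
    have hVle : V ≤ V ^ 75 := le_self_pow₀ hV1 (by norm_num)
    have h1 : V ^ 75 = h ^ (75 * B) := by rw [hVdef, ← pow_mul, mul_comm]
    have h2 : h ^ (75 * B) ≤ (t ^ a) ^ (75 * B) := pow_le_pow_left₀ hh0.le hha _
    have h3 : (t ^ a) ^ (75 * B) = t ^ (3 / 40 : ℝ) := by
      rw [← Real.rpow_natCast, ← Real.rpow_mul ht0.le]
      congr 1; push_cast
      calc a * (75 * (B : ℝ)) = 75 * (a * B) := by ring
        _ = 3 / 40 := by rw [haB]; norm_num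
    have h4 : t ^ (3 / 40 : ℝ) ≤ t := by
      conv_rhs => rw [← Real.rpow_one t]
      exact Real.rpow_le_rpow_of_exponent_le ht1 (by norm_num)
    have hVt : V ≤ t := by rw [h1] at hVle; linarith
    have h6 : (H : ℝ) * t ≤ Real.exp t / 8 := by
      calc (H : ℝ) * t ≤ Real.exp (t ^ a) * t := mul_le_mul_of_nonneg_right hHle ht0.le
        _ ≤ 1 / 8 * Real.exp t := hgrow
        _ = Real.exp t / 8 := by ring
    have h7 : (H : ℝ) * V ≤ (H : ℝ) * t := mul_le_mul_of_nonneg_left hVt hH0.le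
    rw [h2H]
    calc 2 * (H : ℝ) * V = 2 * ((H : ℝ) * V) := by ring
      _ ≤ (X : ℝ) := by rw [hXt]; linarith
      _ ≤ _ := hXX'
  · -- `2H ≤ exp(√(log X'/2))`
    have h3 : Real.sqrt (t / 2) ≤ Real.sqrt (Real.log ((X + 2 * H : ℕ) : ℝ) / 2) :=
      Real.sqrt_le_sqrt (by linarith)
    have h2H0 : (0 : ℝ) < ((2 * H : ℕ) : ℝ) := by rw [h2H]; linarith
    calc ((2 * H : ℕ) : ℝ) = Real.exp (Real.log ((2 * H : ℕ) : ℝ)) := (Real.exp_log h2H0).symm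
      _ ≤ _ := Real.exp_le_exp.2 (by rw [hlog2Hr]; linarith)
  · -- `log 2H ≤ V`
    have h2 : Real.log 2 + h ≤ h ^ 2 := by have := Real.log_two_lt_d9; nlinarith
    have h3 : h ^ 2 ≤ V := by rw [hVdef]; exact pow_le_pow_right₀ hh1 hB2
    rw [hlog2Hr]; linarith
  · -- the pretentiousness inequality
    have hlogh : Real.log h ≤ a * Real.log t := by
      calc Real.log h ≤ Real.log (t ^ a) := Real.log_le_log hh0 hha
        _ = a * Real.log t := Real.log_rpow ht0 a
    have h2 : 5 * 12 * Real.log V ≤ (6 / 100 : ℝ) * Real.log t := by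
      rw [hlogV]
      have : (B : ℝ) * Real.log h ≤ B * (a * Real.log t) :=
        mul_le_mul_of_nonneg_left hlogh hB0.le
      calc 5 * 12 * ((B : ℝ) * Real.log h) ≤ 60 * (B * (a * Real.log t)) := by linarith
        _ = 60 * (a * B) * Real.log t := by ring
        _ = (6 / 100 : ℝ) * Real.log t := by rw [haB]; norm_num
    have h4 : Real.log t ≤ Real.log (Real.log ((X + 2 * H : ℕ) : ℝ)) :=
      Real.log_le_log ht0 hlogX'
    have h5 : 0 ≤ Real.log t := Real.log_nonneg ht1
    linarith

set_option maxHeartbeats 800000 in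
/-- **The regime of Lemma 2.11 / the remaining growth facts** ([LichtmanTeravainen2022, §4]):
`10 < P₁ ≤ Q₁ ≤ X`, `√X' ≤ X`, `exp(√(log √X')) ≤ X^{1/4}`, `log P₁/log Q₁ ≤ 2000 B log log H/log H`,
`X^{7/8} log H ≤ X`, the truncation `2 H² (log X)^ℓ ≤ HX/log H`, `X ≤ HX log log H/log H`,
`log log X' ≤ 2 log H`, `(log X)^{ℓ j} ≤ (2H)^{j-1}` and `4H + max A ≤ X`.
[cite: LichtmanTeravainen2022, §4] -/
theorem regime_rest {t h a ε s₂ : ℝ} {X H B ℓ j SupA : ℕ} (hB1 : 1 ≤ B) (hj1 : 1 ≤ j)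
    (hjε : (ℓ : ℝ) ≤ ε * ((j : ℝ) - 1))
    (ht16 : 16 ≤ t) (hXt : (X : ℝ) = Real.exp t)
    (hh2 : 2 ≤ h) (hhe : Real.exp 1 ≤ h) (hHh : (H : ℝ) = Real.exp h) (hha : h ≤ t ^ a)
    (hat : t ^ a ≤ t) (hlogt : Real.log t ≤ h) (hHlo : t ^ ((ℓ : ℝ) + ε) ≤ H)
    (hV1015 : (h ^ B) ^ 1015 ≤ ((2 * H : ℕ) : ℝ)) (h8H : 8 * (H : ℝ) ≤ X)
    (hSupA : 2 * (SupA : ℝ) + 16 ≤ X)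
    (hs₂ : s₂ ≤ h) (hs₂' : ∀ x : ℝ, s₂ ≤ x → Real.log x ≤ 1 / (30 * (B : ℝ)) * x)
    (hgrow : Real.exp (t ^ a) * t ^ (ℓ + 1) ≤ 1 / 8 * Real.exp t)
    (hexp8 : t ≤ Real.exp (t / 8)) :
    10 < ((h ^ B) ^ 5) ^ 200 ∧
    ((h ^ B) ^ 5) ^ 200 ≤ ((2 * H : ℕ) : ℝ) / ((h ^ B) ^ 5) ^ 3 ∧
    ((2 * H : ℕ) : ℝ) / ((h ^ B) ^ 5) ^ 3 ≤ X ∧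
    0 < Real.sqrt ((X + 2 * H : ℕ) : ℝ) ∧ Real.sqrt ((X + 2 * H : ℕ) : ℝ) ≤ X ∧
    Real.exp (Real.sqrt (Real.log (Real.sqrt ((X + 2 * H : ℕ) : ℝ)))) ≤ (X : ℝ) ^ (1 / 4 : ℝ) ∧
    Real.log (((h ^ B) ^ 5) ^ 200) / Real.log (((2 * H : ℕ) : ℝ) / ((h ^ B) ^ 5) ^ 3) ≤
      2000 * B * Real.log h / h ∧
    0 ≤ Real.log (((h ^ B) ^ 5) ^ 200) / Real.log (((2 * H : ℕ) : ℝ) / ((h ^ B) ^ 5) ^ 3) ∧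
    (X : ℝ) ^ (7 / 8 : ℝ) * h ≤ X ∧
    (H : ℝ) * (2 * H * t ^ ℓ) ≤ H * X / h ∧
    (X : ℝ) ≤ H * X * Real.log h / h ∧ 1 / h ≤ Real.log h / h ∧
    Real.log (Real.log ((X + 2 * H : ℕ) : ℝ)) ≤ 2 * h ∧
    0 ≤ Real.log (Real.log (X : ℝ)) ∧
    Real.log X ^ (ℓ * j) ≤ ((2 * H : ℕ) : ℝ) ^ (j - 1) ∧
    4 * H + SupA ≤ X ∧ 1 ≤ Real.log h := by
  have ht1 : 1 ≤ t := by linarith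
  have ht0 : 0 < t := by linarith
  have hh1 : 1 ≤ h := by linarith
  have hh0 : 0 < h := by linarith
  have hX0 : (0 : ℝ) < X := by rw [hXt]; exact Real.exp_pos t
  have hH0 : (0 : ℝ) < H := by rw [hHh]; exact Real.exp_pos h
  have htX : t = Real.log X := by rw [hXt, Real.log_exp]
  have hB0 : (0 : ℝ) < B := by exact_mod_cast (show 0 < B by omega)
  set V : ℝ := h ^ B with hVdef
  have hV1 : 1 ≤ V := one_le_pow₀ hh1
  have hV0 : 0 < V := by linarith
  have hV2 : 2 ≤ V := hh2.trans (by rw [hVdef]; exact le_self_pow₀ hh1 (by omega))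
  have hlogV : Real.log V = B * Real.log h := by rw [hVdef, Real.log_pow]
  have h2H : ((2 * H : ℕ) : ℝ) = 2 * H := by push_cast; ring
  have h2H0 : (0 : ℝ) < ((2 * H : ℕ) : ℝ) := by rw [h2H]; linarith
  have h2HX : 2 * (H : ℝ) ≤ X := by linarith
  have hXX' : (X : ℝ) ≤ ((X + 2 * H : ℕ) : ℝ) := by push_cast; linarith
  have hX'0 : (0 : ℝ) < ((X + 2 * H : ℕ) : ℝ) := by linarith
  have hX16 : (16 : ℝ) ≤ X := by
    have : (0 : ℝ) ≤ SupA := Nat.cast_nonneg _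
    linarith
  have hYX2 : ((X + 2 * H : ℕ) : ℝ) ≤ (X : ℝ) * X := by push_cast; nlinarith
  have hlogX' : t ≤ Real.log ((X + 2 * H : ℕ) : ℝ) := by
    rw [htX]; exact Real.log_le_log hX0 hXX'
  have hlogX'le : Real.log ((X + 2 * H : ℕ) : ℝ) ≤ 2 * t := by
    calc Real.log ((X + 2 * H : ℕ) : ℝ) ≤ Real.log (X * X) := Real.log_le_log hX'0 hYX2
      _ = 2 * t := by rw [Real.log_mul hX0.ne' hX0.ne', htX]; ring
  have hloglogH : 1 ≤ Real.log h := by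
    rw [← Real.log_exp 1]; exact Real.log_le_log (Real.exp_pos _) hhe
  set P₁ : ℝ := (V ^ 5) ^ 200 with hP₁def
  set Q₁ : ℝ := ((2 * H : ℕ) : ℝ) / (V ^ 5) ^ 3 with hQ₁def
  -- `10 < P₁ ≤ Q₁ ≤ X`
  have hP₁10 : 10 < P₁ := by
    have hV5 : (32 : ℝ) ≤ V ^ 5 := by
      calc (32 : ℝ) = 2 ^ 5 := by norm_num
        _ ≤ V ^ 5 := pow_le_pow_left₀ (by norm_num) hV2 5
    have : V ^ 5 ≤ P₁ := by
      rw [hP₁def]; exact le_self_pow₀ (one_le_pow₀ hV1) (by norm_num)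
    linarith
  have hP₁Q₁ : P₁ ≤ Q₁ := by
    rw [hP₁def, hQ₁def, le_div_iff₀ (by positivity)]
    calc (V ^ 5) ^ 200 * (V ^ 5) ^ 3 = V ^ 1015 := by ring
      _ ≤ ((2 * H : ℕ) : ℝ) := hV1015
  have hQ₁X : Q₁ ≤ X := by
    rw [hQ₁def]
    calc ((2 * H : ℕ) : ℝ) / (V ^ 5) ^ 3 ≤ ((2 * H : ℕ) : ℝ) :=
          div_le_self (Nat.cast_nonneg _) (one_le_pow₀ (one_le_pow₀ hV1))
      _ ≤ X := by rw [h2H]; exact h2HX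
  -- `√X'`
  have hsqrtY0 : 0 < Real.sqrt ((X + 2 * H : ℕ) : ℝ) := Real.sqrt_pos.2 hX'0
  have hsqrtY : Real.sqrt ((X + 2 * H : ℕ) : ℝ) ≤ X := by
    rw [Real.sqrt_le_left hX0.le, sq]; exact hYX2
  have hEX : Real.exp (Real.sqrt (Real.log (Real.sqrt ((X + 2 * H : ℕ) : ℝ)))) ≤
      (X : ℝ) ^ (1 / 4 : ℝ) := by
    have h1 : Real.log (Real.sqrt ((X + 2 * H : ℕ) : ℝ)) =
        Real.log ((X + 2 * H : ℕ) : ℝ) / 2 := Real.log_sqrt hX'0.le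
    have h2 : Real.log ((X + 2 * H : ℕ) : ℝ) / 2 ≤ t := by linarith
    have h3 : Real.sqrt (Real.log (Real.sqrt ((X + 2 * H : ℕ) : ℝ))) ≤ t / 4 := by
      rw [h1]
      exact (Real.sqrt_le_sqrt h2).trans (sqrt_le_div_four ht16)
    calc Real.exp (Real.sqrt (Real.log (Real.sqrt ((X + 2 * H : ℕ) : ℝ)))) ≤ Real.exp (t / 4) :=
          Real.exp_le_exp.2 h3
      _ = (X : ℝ) ^ (1 / 4 : ℝ) := by
          rw [hXt, ← Real.exp_mul]; ring_nf
  -- `ρ ≤ 2000 B log h / h`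
  have hlogP₁ : Real.log P₁ = 1000 * (B * Real.log h) := by
    rw [hP₁def, ← pow_mul, Real.log_pow, hlogV]; push_cast; ring
  have hlogQ₁ : Real.log Q₁ = Real.log 2 + h - 15 * (B * Real.log h) := by
    rw [hQ₁def, Real.log_div h2H0.ne' (by positivity), ← pow_mul, Real.log_pow, hlogV, h2H,
      Real.log_mul (by norm_num) hH0.ne', hHh, Real.log_exp]
    push_cast; ring
  have h15 : 15 * ((B : ℝ) * Real.log h) ≤ h / 2 := by
    have h1 := hs₂' h hs₂
    have h2 : 1 / (30 * (B : ℝ)) * h = h / (30 * B) := by ring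
    rw [h2, le_div_iff₀ (by positivity)] at h1
    nlinarith
  have hden : h / 2 ≤ Real.log Q₁ := by rw [hlogQ₁]; have := Real.log_two_gt_d9; linarith
  have hnum0 : 0 ≤ Real.log P₁ := by rw [hlogP₁]; positivity
  have hρ : Real.log P₁ / Real.log Q₁ ≤ 2000 * B * Real.log h / h := by
    calc Real.log P₁ / Real.log Q₁ ≤ Real.log P₁ / (h / 2) :=
          div_le_div_of_nonneg_left hnum0 (by positivity) hden
      _ = 2000 * B * Real.log h / h := by rw [hlogP₁]; field_simp; ring
  have hρ0 : 0 ≤ Real.log P₁ / Real.log Q₁ := div_nonneg hnum0 (by linarith)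
  -- `X^{7/8} h ≤ X`
  have hX78 : (X : ℝ) ^ (7 / 8 : ℝ) * h ≤ X := by
    have h1 : h ≤ Real.exp (t / 8) := (hha.trans hat).trans hexp8
    have h2 : Real.exp (t / 8) = (X : ℝ) ^ (1 / 8 : ℝ) := by
      rw [hXt, ← Real.exp_mul]; ring_nf
    have h3 : (X : ℝ) ^ (7 / 8 : ℝ) * (X : ℝ) ^ (1 / 8 : ℝ) = X := by
      rw [← Real.rpow_add hX0]; norm_num
    calc (X : ℝ) ^ (7 / 8 : ℝ) * h ≤ (X : ℝ) ^ (7 / 8 : ℝ) * (X : ℝ) ^ (1 / 8 : ℝ) :=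
          mul_le_mul_of_nonneg_left (h1.trans_eq h2) (by positivity)
      _ = X := h3
  -- truncation
  have hHle : (H : ℝ) ≤ Real.exp (t ^ a) := by rw [hHh]; exact Real.exp_le_exp.2 hha
  have htrunc : (H : ℝ) * (2 * H * t ^ ℓ) ≤ H * X / h := by
    have h1 : 2 * (H : ℝ) * t ^ ℓ * h ≤ X := by
      have h0 : (0 : ℝ) ≤ t ^ ℓ := by positivity
      have hm := mul_le_mul hHle (hha.trans hat) hh0.le (Real.exp_pos _).le
      calc 2 * (H : ℝ) * t ^ ℓ * h = 2 * t ^ ℓ * ((H : ℝ) * h) := by ring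
        _ ≤ 2 * t ^ ℓ * (Real.exp (t ^ a) * t) := mul_le_mul_of_nonneg_left hm (by positivity)
        _ = 2 * (Real.exp (t ^ a) * t ^ (ℓ + 1)) := by rw [pow_succ]; ring
        _ ≤ 2 * (1 / 8 * Real.exp t) := by linarith
        _ ≤ (X : ℝ) := by rw [hXt]; linarith [Real.exp_pos t]
    rw [le_div_iff₀ hh0]
    calc (H : ℝ) * (2 * H * t ^ ℓ) * h = H * (2 * H * t ^ ℓ * h) := by ring
      _ ≤ H * X := mul_le_mul_of_nonneg_left h1 hH0.le
  -- `X ≤ HX log h / h`, `1/h ≤ log h/h`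
  have hXle : (X : ℝ) ≤ H * X * Real.log h / h := by
    have h1 : h ≤ (H : ℝ) := by rw [hHh]; linarith [Real.add_one_le_exp h]
    have h2 : h ≤ (H : ℝ) * Real.log h := by nlinarith
    rw [le_div_iff₀ hh0]
    calc (X : ℝ) * h ≤ X * (H * Real.log h) := mul_le_mul_of_nonneg_left h2 hX0.le
      _ = H * X * Real.log h := by ring
  have hrate : 1 / h ≤ Real.log h / h := div_le_div_of_nonneg_right hloglogH hh0.le
  -- `log log X' ≤ 2h`, `0 ≤ log log X`
  have hloglogX' : Real.log (Real.log ((X + 2 * H : ℕ) : ℝ)) ≤ 2 * h := by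
    calc Real.log (Real.log ((X + 2 * H : ℕ) : ℝ)) ≤ Real.log (2 * t) :=
          Real.log_le_log (by linarith) hlogX'le
      _ = Real.log 2 + Real.log t := Real.log_mul (by norm_num) ht0.ne'
      _ ≤ 2 * h := by have := Real.log_two_lt_d9; linarith
  have hloglogX0 : 0 ≤ Real.log (Real.log (X : ℝ)) := by rw [← htX]; exact Real.log_nonneg ht1
  -- `(log X)^{ℓ j} ≤ (2H)^{j-1}`
  have hlogpow : Real.log X ^ (ℓ * j) ≤ ((2 * H : ℕ) : ℝ) ^ (j - 1) := by
    have h1 : Real.log X ^ (ℓ * j) = t ^ (((ℓ * j : ℕ)) : ℝ) := by rw [← htX, Real.rpow_natCast]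
    have h2 : (((ℓ * j : ℕ)) : ℝ) ≤ ((ℓ : ℝ) + ε) * ((j - 1 : ℕ) : ℝ) := by
      rw [Nat.cast_sub hj1]; push_cast; nlinarith
    have h3 : t ^ (((ℓ * j : ℕ)) : ℝ) ≤ t ^ (((ℓ : ℝ) + ε) * ((j - 1 : ℕ) : ℝ)) :=
      Real.rpow_le_rpow_of_exponent_le ht1 h2
    have h4 : t ^ (((ℓ : ℝ) + ε) * ((j - 1 : ℕ) : ℝ)) = (t ^ ((ℓ : ℝ) + ε)) ^ (j - 1) := by
      rw [Real.rpow_mul ht0.le, Real.rpow_natCast]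
    have h5 : (t ^ ((ℓ : ℝ) + ε)) ^ (j - 1) ≤ (H : ℝ) ^ (j - 1) :=
      pow_le_pow_left₀ (by positivity) hHlo _
    have h6 : (H : ℝ) ^ (j - 1) ≤ ((2 * H : ℕ) : ℝ) ^ (j - 1) :=
      pow_le_pow_left₀ hH0.le (by rw [h2H]; linarith) _
    rw [h1]; linarith [h3.trans_eq h4]
  -- `4H + SupA ≤ X`
  have h4HA : 4 * H + SupA ≤ X := by
    have : 4 * (H : ℝ) + (SupA : ℝ) ≤ X := by linarith
    exact_mod_cast this
  exact ⟨hP₁10, hP₁Q₁, hQ₁X, hsqrtY0, hsqrtY, hEX, hρ, hρ0, hX78, htrunc, hXle, hrate, hloglogX',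
    hloglogX0, hlogpow, h4HA, hloglogH⟩


end Literature.NumberTheory.Sieve.LichtmanTeravainen2022.Liouville
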